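import Literature.AlgebraicGeometry.Resolution.LogRegularResolution
import Mathlib.AlgebraicGeometry.AffineScheme
import Mathlib.AlgebraicGeometry.Noetherian
import Mathlib.RingTheory.Localization.AtPrime.Basic
import Mathlib.RingTheory.Ideal.Quotient.Operations
import Mathlib.GroupTheory.Subgroup.Saturated
import HarnessLib

/-!
# Logarithmically regular schemes (Kato 1994): fs Zariski log structures by finitely many charts

Topic: `Literature/AlgebraicGeometry/Resolution`. Definition request `defn-LogRegularScheme`: the
GLOBAL form of the one-chart affine predicate `LogChart.IsLogRegularAt` of
`LogRegularResolution.lean` — a scheme `X` covered by finitely many Zariski opens `U_i`, each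
carrying a chart `φ_i : P_i → (Γ(X, U_i), ·)` by a finitely generated saturated monoid
`P_i ⊆ ℤ^{n_i}` spanning `ℤ^{n_i}` (an fs monoid with `P_iᵍᵖ = ℤ^{n_i}`), the charts agreeing on
overlaps, together with Kato's regularity condition (Def. (2.1)) at every point of every chart.

## Sources (text read)

* [Kato1994] K. Kato, *Toric singularities*, Amer. J. Math. 116 (1994) 1073–1099: (1.1) monoids,
  integral / saturated; (1.2)–(1.3) (pre-)log structures and the associated log structure `Pᵃ`;
  (1.5) condition (S): "`X` is locally Noetherian, and there exists an open covering `{U_λ}_λ` of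
  `X`, finitely generated saturated monoids `P_λ`, and homomorphisms `h_λ : P_λ → 𝒪_{U_λ}` such that
  `M|_{U_λ}` is isomorphic to the log. str. associated to the pre-log. str. `(P_λ, h_λ)` for each
  `λ`"; (1.6); (1.7); (1.8) (Zariski sites); Def. (2.1): "(X, M) is (logarithmically) regular at `x`
  if, with `I(x, M)` the ideal of `𝒪_{X,x}` generated by the image of `M_x ∖ 𝒪^×_{X,x}`,
  (i) `𝒪_{X,x}/I(x, M)` is a regular local ring; (ii) `dim 𝒪_{X,x} = dim (𝒪_{X,x}/I(x, M)) +
  rank_ℤ (M_xᵍᵖ/𝒪^×_{X,x})`. We say `(X, M)` is regular if `(X, M)` is regular at all `x ∈ X`";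
  (2.2)(1); Thm. (4.1) (log regular ⇒ Cohen–Macaulay and normal); Thm. (11.6) (for `(X, M)` log
  regular, `α : M → 𝒪_X` is injective and `M = 𝒪_X ∩ j_* 𝒪^×_U`, `U` the open set of triviality).
* [Niziol2006] W. Nizioł, *Toric singularities: log-blow-ups and global resolutions*, J. Algebraic
  Geom. 15 (2006) 1–29: Def. 2.2 (the same definition for fs log structures on the étale site),
  Lemma 2.3 (with a chart it agrees with Kato's Zariski notion), Prop. 2.6 (étale form of (11.6)).

## Rendering

The tree has no sheaves of monoids / log structures, so a log structure with property (S) is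
presented by its ATLAS OF CHARTS (`LogAtlas X`): finitely many opens `U_i` covering `X` (Kato (10.4)
assumes `X` quasi-compact, and a chart restricted to a smaller open is again a chart, so finitely
many charts is no restriction there), fs monoids in the normal form `P_i ⊆ ℤ^{n_i}` finitely
generated, saturated (`AddSubmonoid.NSMulSaturated`, Kato (1.1)) and spanning `ℤ^{n_i}` (every fs
monoid `P` with `Pᵍᵖ` torsion free is of this form, and by Kato (1.6) every point of an (S) log
scheme has a neighbourhood with a chart by the sharp fs monoid `M_x/𝒪^×_{X,x}`, whose group
completion is free — so this normal form is no restriction either), monoid homomorphisms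
`φ_i : P_i → (Γ(X, U_i), ·)`, and the COMPATIBILITY on overlaps: at every `x ∈ U_i ∩ U_j` the two
charts generate the same submonoid of `𝒪_{X,x}` up to units,
`𝒪^×_{X,x} · φ_i(P_i) = 𝒪^×_{X,x} · φ_j(P_j)` (`LogAtlas.chart_compatible`: every `φ_i(p)` is a unit
multiple of some `φ_j(q)` in `𝒪_{X,x}`, and symmetrically). This is implied by
`P_iᵃ|_{U_i ∩ U_j} ≅ P_jᵃ|_{U_i ∩ U_j}` (the image of `M_x → 𝒪_{X,x}` is `𝒪^×_{X,x} · φ_i(P_i)` for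
`M = P_iᵃ`), and is EQUIVALENT to it as soon as the structure maps `P_iᵃ → 𝒪_{U_i}` are injective,
which is the case for log regular `(U_i, P_iᵃ)` by Kato (11.6) (first step of its proof, with the
normality (4.1)); two sub-monoid-sheaves of `𝒪_X` agree iff they agree stalkwise.

Kato's (2.1) at `x ∈ U_i` only involves `M_x → 𝒪_{X,x}` through the chart: for `M = P_iᵃ`,
`M_x/𝒪^×_{X,x} = P_i/F` with `F = φ_{i,x}⁻¹(𝒪^×_{X,x})` the face of elements that are units at `x`,
so `rank_ℤ (M_xᵍᵖ/𝒪^×_{X,x}) = rank (P_iᵍᵖ/Fᵍᵖ) = n_i − rank_ℤ Fᵍᵖ`, and `I(x, M)` is the ideal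
generated by `φ_{i,x}(P_i ∖ F)`. This is `LogChart.IsLogRegularLocal` (Kato (2.1) for one chart
through a local ring; for `A`, `𝔭` and the local ring `A_𝔭` it is literally the existing
`LogChart.IsLogRegularAt`, `LogChart.isLogRegularAt_iff_isLogRegularLocal`), and
`LogAtlas.IsLogRegular 𝒜` asks it at every point of every chart, plus `X` locally Noetherian
(part of (S)).

**Faithfulness.** `𝒜.IsLogRegular` holds iff the charts of `𝒜` are fs Zariski charts (condition
(S)) of a log structure `M` on `X` with `(X, M)` log regular in the sense of Kato (2.1); `M` is then
unique, `M = 𝒪_X ∩ j_* 𝒪^×_{X_tr}` (11.6). Indeed, given `IsLogRegular`, each `(U_i, P_iᵃ)` is an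
(S) log scheme, log regular by the computation above, so `P_iᵃ ↪ 𝒪_{U_i}` (11.6) with stalk image
`𝒪^× · φ_i(P_i)`; by `chart_compatible` these subsheaves of `𝒪_X` agree on overlaps and glue to a
subsheaf of monoids `M ⊇ 𝒪^×_X` of `𝒪_X` with `M|_{U_i} = P_iᵃ` — a log structure with (S), log
regular. Conversely an (S) log regular `(X, M)` on a quasi-compact `X` has finitely many charts of
the normal form above, each `P_iᵃ ≅ M|_{U_i}`, so the stalk images agree (compatibility) and (2.1)
holds chart by chart. Hence `Scheme.IsLogRegular X` ("some finite fs Zariski atlas on `X` is log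
regular") says exactly that the quasi-compact-style `X` underlies a log regular (S) log scheme, i.e.
has at worst toric singularities in Kato's sense; `LogRegularScheme` bundles the data.

## API (all proved)

* `LogChart.isLogRegularAt_iff_isLogRegularLocal` (the affine one-chart predicate is the case
  `R = A_𝔭`), `LogChart.isLogRegularLocal_comp_equiv` (invariance under ring isomorphisms),
  `LogChart.isLogRegularLocal_iff_of_forall_isUnit` (where the chart is by units, log regular =
  regular, Kato (2.2)(1)).
* `LogAtlas.isLogRegularLocal_stalkChart_iff`: on an affine open `V ⊆ U_i` the stalk condition at
  `x ∈ V` is `LogChart.IsLogRegularAt` for the ring `Γ(X, V)` at the prime of `x`.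
* `LogAtlas.trivialLocus` (the open set of triviality `X_tr`), `mem_trivialLocus_iff` (chart
  independence, from compatibility), `isOpen_trivialLocus`, and
  `IsLogRegular.isRegularLocalRing_of_mem_trivialLocus` (Kato (2.2)(1): `X` is regular on `X_tr`).
* `LogAtlas.trivialStructure` / `isLogRegular_trivialStructure_iff` (trivial log structure: log
  regular iff regular and locally Noetherian), `LogAtlas.ofAffineChart` /
  `isLogRegular_ofAffineChart_iff` (one global chart on `Spec A`: log regular iff `A` is Noetherian
  and `LogChart.IsLogRegularAt P φ 𝔭` at every prime — the hypothesis of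
  `Kato1994_logRegular_hasResolution`), `LogAtlas.reindex`, `Scheme.IsLogRegular`,
  `LogAtlas.IsLogRegular.isLogRegular_scheme`, `LogRegularScheme`.

## What is NOT here

* The étale-site version (Nizioł 2006 §2.1, Kato (1.8): charts on an étale cover `U_i → X`,
  compatibility on `U_i ×_X U_j`), needed for toroidal embeddings WITH self-intersection —
  TODO(general form), a separate file.
* No PROOF of any theorem of Kato's beyond the definitional sanity lemmas: not (4.1) (normal,
  Cohen–Macaulay), not (3.1)/(3.2) (completed local rings `R[[P]]/(θ)`, `k[[P]][[T₁,…,T_r]]`), not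
  (7.1) (localization), not (11.6) (`M = 𝒪_X ∩ j_*𝒪^×`, density of `X_tr`), and not the example
  (1.7)/(2.2)(2) (snc pairs are log regular); none of these is vendored as a fact either.
* Log structures themselves (sheaves of monoids), morphisms of log schemes, log smoothness, fans,
  the fibre product `(X, M) ×_F F'`, log blow-ups.

## The named fact (ONE, D-0014)

`Kato1994_logRegularScheme_hasResolution`: Kato (10.4) with (9.8), (9.11), (10.3) — a quasi-compact
log regular scheme (several Zariski charts) has a resolution of singularities in the weak sense of
the tree (`Scheme.HasResolution`); = Nizioł 2006 Thm. 5.8 without the log-blow-up refinement. It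
implies the one-chart affine fact `Kato1994_logRegular_hasResolution` of `LogRegularResolution.lean`
(`Kato1994_logRegularScheme_hasResolution.one_chart`, proved). Text read: Kato pp. 1089–1092
((9.6)–(9.11), (10.1)–(10.4)).
-/

noncomputable section

open AlgebraicGeometry CategoryTheory TopologicalSpace Opposite

namespace Literature.AlgebraicGeometry.Resolution

universe w w' u

/-! ## Kato's condition (2.1) for one chart through a (local) ring -/

namespace LogChart

variable {n : ℕ} {R : Type u} [CommRing R] {S : Type u} [CommRing S]

/-- The **face of units** of a chart `φ : P → (R, ·)`: the elements of `P` that `φ` maps to units of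
`R`. For `R = 𝒪_{X,x}` and the log structure `M = Pᵃ` of the chart this is `F = φ⁻¹(𝒪^×_{X,x})`, and
`M_x/𝒪^×_{X,x} = P/F`. [cite: Kato1994, (1.3) and Def. (2.1)] -/
def unitFace (P : AddSubmonoid (Fin n → ℤ)) (φ : Multiplicative P →* R) : Set P :=
  {p | IsUnit (φ (Multiplicative.ofAdd p))}

/-- Membership in the face of units (`rfl`). [cite: Kato1994, Def. (2.1)] -/
@[simp] theorem mem_unitFace_iff {P : AddSubmonoid (Fin n → ℤ)} {φ : Multiplicative P →* R}
    {p : P} : p ∈ unitFace P φ ↔ IsUnit (φ (Multiplicative.ofAdd p)) :=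
  Iff.rfl

/-- **Kato's ideal `I(x, M)`** for a chart `φ : P → (R, ·)` through the local ring `R = 𝒪_{X,x}`:
the ideal of `R` generated by `φ(P ∖ F)`, the images of the chart elements that are NOT units
(= the ideal generated by the image of `M_x ∖ 𝒪^×_{X,x}` for `M = Pᵃ`).
[cite: Kato1994, Def. (2.1)] -/
def nonunitIdeal (P : AddSubmonoid (Fin n → ℤ)) (φ : Multiplicative P →* R) : Ideal R :=
  Ideal.span ((fun p : P => φ (Multiplicative.ofAdd p)) ''
    {p | ¬ IsUnit (φ (Multiplicative.ofAdd p))})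

/-- In a local ring Kato's ideal is contained in the maximal ideal. [cite: Kato1994, Def. (2.1)] -/
theorem nonunitIdeal_le_maximalIdeal [IsLocalRing R] (P : AddSubmonoid (Fin n → ℤ))
    (φ : Multiplicative P →* R) : nonunitIdeal P φ ≤ IsLocalRing.maximalIdeal R := by
  refine Ideal.span_le.2 ?_
  rintro _ ⟨p, hp, rfl⟩
  exact (IsLocalRing.mem_maximalIdeal _).2 hp

/-- If every chart element is a unit, Kato's ideal vanishes. [cite: Kato1994, (2.2)(1)] -/
theorem nonunitIdeal_eq_bot_of_forall_isUnit (P : AddSubmonoid (Fin n → ℤ))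
    (φ : Multiplicative P →* R) (h : ∀ p : P, IsUnit (φ (Multiplicative.ofAdd p))) :
    nonunitIdeal P φ = ⊥ := by
  rw [nonunitIdeal, Ideal.span_eq_bot]
  rintro _ ⟨p, hp, rfl⟩
  exact (hp (h p)).elim

/-- **Logarithmic regularity for one chart through a local ring** (Kato 1994, Def. (2.1); Nizioł
2006, Def. 2.2): for `φ : P → (R, ·)` with `P ⊆ ℤⁿ` spanning `ℤⁿ` and `R = 𝒪_{X,x}`, so that for
`M = Pᵃ` one has `I(x, M) = φ(P ∖ F)·R` (`nonunitIdeal`) and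
`rank_ℤ (M_xᵍᵖ/𝒪^×_{X,x}) = rank (Pᵍᵖ/Fᵍᵖ) = n − rank_ℤ Fᵍᵖ` (`F = unitFace P φ`, `Fᵍᵖ` = the
`ℤ`-span of `F` in `ℤⁿ`, of rank `≤ n`):
(i) `R/I` is a regular local ring, and (ii) `dim R = dim (R/I) + (n − rank_ℤ Fᵍᵖ)`.
[cite: Kato1994, Def. (2.1)] [cite: Niziol2006, Def. 2.2] -/
def IsLogRegularLocal (P : AddSubmonoid (Fin n → ℤ)) (φ : Multiplicative P →* R) : Prop :=
  IsRegularLocalRing (R ⧸ nonunitIdeal P φ) ∧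
    ringKrullDim R = ringKrullDim (R ⧸ nonunitIdeal P φ) +
      ((n - Module.finrank ℤ
          (Submodule.span ℤ ((fun p : P => (p : Fin n → ℤ)) '' unitFace P φ)) : ℕ) : WithBot ℕ∞)

/-! ### The affine one-chart predicate is the case `R = A_𝔭` -/

section Localization

variable {A : Type u} [CommRing A]

/-- In `A_𝔭` the face of units of `A → A_𝔭 ∘ φ` is the face `F_𝔭 = {p | φ p ∉ 𝔭}` of
`LogChart.face`. [cite: Kato1994, Def. (2.1)] -/
theorem unitFace_algebraMap (P : AddSubmonoid (Fin n → ℤ)) (φ : Multiplicative P →* A)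
    (𝔭 : Ideal A) [𝔭.IsPrime] :
    unitFace P ((algebraMap A (Localization.AtPrime 𝔭)).toMonoidHom.comp φ) = face P φ 𝔭 := by
  ext p
  simp only [mem_unitFace_iff, MonoidHom.coe_comp, Function.comp_apply, RingHom.toMonoidHom_eq_coe,
    MonoidHom.coe_coe, mem_face_iff]
  rw [IsLocalization.AtPrime.isUnit_to_map_iff (Localization.AtPrime 𝔭) 𝔭, Ideal.mem_primeCompl_iff]

/-- In `A_𝔭` Kato's ideal of `A → A_𝔭 ∘ φ` is the extension of `LogChart.ideal P φ 𝔭`.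
[cite: Kato1994, Def. (2.1)] -/
theorem nonunitIdeal_algebraMap (P : AddSubmonoid (Fin n → ℤ)) (φ : Multiplicative P →* A)
    (𝔭 : Ideal A) [𝔭.IsPrime] :
    nonunitIdeal P ((algebraMap A (Localization.AtPrime 𝔭)).toMonoidHom.comp φ) =
      (ideal P φ 𝔭).map (algebraMap A (Localization.AtPrime 𝔭)) := by
  rw [nonunitIdeal, ideal, Ideal.map_span, ← Set.image_comp]
  congr 1
  ext y
  simp only [Set.mem_image, Set.mem_setOf_eq, MonoidHom.coe_comp, Function.comp_apply,
    RingHom.toMonoidHom_eq_coe, MonoidHom.coe_coe]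
  constructor
  · rintro ⟨p, hp, rfl⟩
    refine ⟨p, ?_, rfl⟩
    by_contra h
    exact hp ((IsLocalization.AtPrime.isUnit_to_map_iff (Localization.AtPrime 𝔭) 𝔭 _).2 h)
  · rintro ⟨p, hp, rfl⟩
    refine ⟨p, fun h => ?_, rfl⟩
    exact ((IsLocalization.AtPrime.isUnit_to_map_iff (Localization.AtPrime 𝔭) 𝔭 _).1 h) hp

/-- `LogChart.IsLogRegularAt P φ 𝔭` (the one-chart affine predicate of `LogRegularResolution.lean`)
is `LogChart.IsLogRegularLocal` for the chart `A → A_𝔭 ∘ φ` through the local ring `A_𝔭`.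
[cite: Kato1994, Def. (2.1)] -/
theorem isLogRegularAt_iff_isLogRegularLocal (P : AddSubmonoid (Fin n → ℤ))
    (φ : Multiplicative P →* A) (𝔭 : Ideal A) [𝔭.IsPrime] :
    IsLogRegularAt P φ 𝔭 ↔
      IsLogRegularLocal P ((algebraMap A (Localization.AtPrime 𝔭)).toMonoidHom.comp φ) := by
  rw [IsLogRegularLocal, nonunitIdeal_algebraMap, unitFace_algebraMap]
  rfl

end Localization

/-! ### Invariance under isomorphisms of the local ring -/

/-- The face of units is unchanged by composing the chart with a ring isomorphism. [folklore] -/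
theorem unitFace_comp_equiv (P : AddSubmonoid (Fin n → ℤ)) (φ : Multiplicative P →* R)
    (e : R ≃+* S) : unitFace P (e.toMonoidHom.comp φ) = unitFace P φ := by
  ext p
  simp only [mem_unitFace_iff, MonoidHom.coe_comp, Function.comp_apply]
  exact isUnit_map_iff e _

/-- Kato's ideal of the composite with a ring isomorphism `e` is the image of Kato's ideal by `e`.
[folklore] -/
theorem nonunitIdeal_comp_equiv (P : AddSubmonoid (Fin n → ℤ)) (φ : Multiplicative P →* R)
    (e : R ≃+* S) :
    nonunitIdeal P (e.toMonoidHom.comp φ) = (nonunitIdeal P φ).map (e : R →+* S) := by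
  rw [nonunitIdeal, nonunitIdeal, Ideal.map_span, ← Set.image_comp]
  congr 1
  ext y
  simp only [Set.mem_image, Set.mem_setOf_eq, MonoidHom.coe_comp, Function.comp_apply,
    RingHom.coe_coe]
  constructor
  · rintro ⟨p, hp, rfl⟩
    exact ⟨p, fun h => hp ((isUnit_map_iff e _).2 h), rfl⟩
  · rintro ⟨p, hp, rfl⟩
    exact ⟨p, fun h => hp ((isUnit_map_iff e _).1 h), rfl⟩

/-- Log regularity of a chart through a local ring is invariant under isomorphisms of the ring
(used to pass between `𝒪_{X,x}` and `A_𝔭` on affine opens). [folklore] -/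
theorem isLogRegularLocal_comp_equiv (P : AddSubmonoid (Fin n → ℤ)) (φ : Multiplicative P →* R)
    (e : R ≃+* S) : IsLogRegularLocal P (e.toMonoidHom.comp φ) ↔ IsLogRegularLocal P φ := by
  have hI := nonunitIdeal_comp_equiv P φ e
  let eq : R ⧸ nonunitIdeal P φ ≃+* S ⧸ nonunitIdeal P (e.toMonoidHom.comp φ) :=
    Ideal.quotientEquiv _ _ e hI
  rw [IsLogRegularLocal, IsLogRegularLocal, unitFace_comp_equiv, ← ringKrullDim_eq_of_ringEquiv e,
    ← ringKrullDim_eq_of_ringEquiv eq]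
  constructor
  · rintro ⟨h, hdim⟩
    exact ⟨IsRegularLocalRing.of_ringEquiv eq.symm, hdim⟩
  · rintro ⟨h, hdim⟩
    exact ⟨IsRegularLocalRing.of_ringEquiv eq, hdim⟩

/-! ### Charts by units: log regular = regular (Kato (2.2)(1)) -/

/-- If `P` spans `ℤⁿ` then the rank of the `ℤ`-span of all of `P` is `n`. [folklore] -/
theorem finrank_span_image_univ (P : AddSubmonoid (Fin n → ℤ))
    (hspan : Submodule.span ℤ (P : Set (Fin n → ℤ)) = ⊤) :
    Module.finrank ℤ (Submodule.span ℤ ((fun p : P => (p : Fin n → ℤ)) '' Set.univ)) = n := by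
  have himg : ((fun p : P => (p : Fin n → ℤ)) '' Set.univ) = (P : Set (Fin n → ℤ)) := by
    ext v
    simp only [Set.image_univ, Set.mem_range, Subtype.exists, exists_prop, exists_eq_right]
    rfl
  rw [himg, hspan, finrank_top, Module.finrank_fin_fun]

/-- **Kato (2.2)(1)** for a chart by units: if `φ(P) ⊆ R^×` (the log structure `Pᵃ` is trivial at
the point) and `P` spans `ℤⁿ`, then log regularity is the regularity of the local ring `R`.
[cite: Kato1994, (2.2)(1)] -/
theorem isLogRegularLocal_iff_of_forall_isUnit (P : AddSubmonoid (Fin n → ℤ))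
    (hspan : Submodule.span ℤ (P : Set (Fin n → ℤ)) = ⊤) (φ : Multiplicative P →* R)
    (h : ∀ p : P, IsUnit (φ (Multiplicative.ofAdd p))) :
    IsLogRegularLocal P φ ↔ IsRegularLocalRing R := by
  have hbot : nonunitIdeal P φ = ⊥ := nonunitIdeal_eq_bot_of_forall_isUnit P φ h
  have hface : unitFace P φ = Set.univ := Set.eq_univ_of_forall h
  let e : (R ⧸ nonunitIdeal P φ) ≃+* R := (Ideal.quotEquivOfEq hbot).trans (RingEquiv.quotientBot R)
  have hdim := ringKrullDim_eq_of_ringEquiv e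
  have hfin : (n - Module.finrank ℤ
      (Submodule.span ℤ ((fun p : P => (p : Fin n → ℤ)) '' unitFace P φ)) : ℕ) = 0 := by
    rw [hface, finrank_span_image_univ P hspan, Nat.sub_self]
  constructor
  · rintro ⟨h, -⟩
    exact IsRegularLocalRing.of_ringEquiv e
  · intro hR
    refine ⟨IsRegularLocalRing.of_ringEquiv e.symm, ?_⟩
    rw [hdim, hfin, Nat.cast_zero, add_zero]

/-- For the trivial chart (`n = 0`) log regularity is regularity of `R`.
[cite: Kato1994, (2.2)(1)] -/
theorem isLogRegularLocal_zero_iff (P : AddSubmonoid (Fin 0 → ℤ)) (φ : Multiplicative P →* R) :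
    IsLogRegularLocal P φ ↔ IsRegularLocalRing R := by
  refine isLogRegularLocal_iff_of_forall_isUnit P ?_ φ fun p => ?_
  · exact Subsingleton.elim _ _
  · have h0 : p = 0 := Subsingleton.elim _ _
    rw [h0, ofAdd_zero, map_one]
    exact isUnit_one

end LogChart

/-! ## Atlases of fs Zariski charts (Kato's condition (S)) -/

/-- An **atlas of fs Zariski charts** on a scheme `X` (the data of Kato's condition (S), with
finitely many charts in the normal form of `LogRegularResolution.lean`): a finite index type `ι`;
opens `U i` covering `X`; for each `i` a submonoid `P i ⊆ ℤ^{rk i}` which is finitely generated,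
saturated (`k • v ∈ P i`, `k ≠ 0` ⇒ `v ∈ P i`, Kato (1.1)) and spans `ℤ^{rk i}` (an fs monoid with
`(P i)ᵍᵖ = ℤ^{rk i}`); a monoid homomorphism `chart i : P i → (Γ(X, U i), ·)`; and the
compatibility of the charts on overlaps: at each `x ∈ U i ∩ U j`, every `φ_i(p)` is a unit multiple
in `𝒪_{X,x}` of some `φ_j(q)` (and symmetrically, the condition being stated for all pairs), i.e.
`𝒪^×_{X,x}·φ_i(P i) = 𝒪^×_{X,x}·φ_j(P j)` — the stalks of the associated log structures `(P i)ᵃ`,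
`(P j)ᵃ` have the same image in `𝒪_{X,x}`; this is implied by, and for charts whose associated log
structures inject into `𝒪_X` (all log regular ones, Kato (11.6)) equivalent to,
`(P i)ᵃ|_{U i ∩ U j} ≅ (P j)ᵃ|_{U i ∩ U j}` (see the module docstring, "Faithfulness").
[cite: Kato1994, (1.5) condition (S), (1.3), (1.6)] -/
structure LogAtlas (X : Scheme.{u}) where
  /-- the (finite) index type of the charts -/
  ι : Type w
  /-- there are finitely many charts -/
  [finite_index : Finite ι]
  /-- the domain `U i ⊆ X` of the `i`-th chart -/
  U : ι → X.Opens
  /-- the chart domains cover `X` -/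
  exists_mem : ∀ x : X, ∃ i, x ∈ U i
  /-- the rank `n_i` of the lattice `ℤ^{n_i} = (P i)ᵍᵖ` -/
  rk : ι → ℕ
  /-- the chart monoid `P i ⊆ ℤ^{n_i}` -/
  P : (i : ι) → AddSubmonoid (Fin (rk i) → ℤ)
  /-- `P i` is finitely generated -/
  fg : ∀ i, (P i).FG
  /-- `P i` is saturated in `ℤ^{n_i}` -/
  saturated : ∀ i, (P i).NSMulSaturated
  /-- `P i` spans `ℤ^{n_i}` as a group -/
  span_eq_top : ∀ i, Submodule.span ℤ (P i : Set (Fin (rk i) → ℤ)) = ⊤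
  /-- the chart `φ_i : P i → (Γ(X, U i), ·)` -/
  chart : (i : ι) → Multiplicative (P i) →* Γ(X, U i)
  /-- compatibility on overlaps: the charts generate the same submonoid of `𝒪_{X,x}` up to units -/
  chart_compatible : ∀ (i j : ι) (x : X) (hi : x ∈ U i) (hj : x ∈ U j) (p : P i), ∃ q : P j,
    Associated (X.presheaf.germ (U i) x hi (chart i (Multiplicative.ofAdd p)))
      (X.presheaf.germ (U j) x hj (chart j (Multiplicative.ofAdd q)))

namespace LogAtlas

variable {X : Scheme.{u}} (𝒜 : LogAtlas.{w} X)

/-- The index type of an atlas is finite (the structure field, registered as an instance; it is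
about the new structure `LogAtlas` only and overrides nothing). [cite: Kato1994, (1.5)] -/
instance finite_ι : Finite 𝒜.ι :=
  𝒜.finite_index

/-- The chart domains cover `X`. [cite: Kato1994, (1.5)] -/
theorem iSup_eq_top : ⨆ i, 𝒜.U i = ⊤ :=
  top_unique fun x _ => Opens.mem_iSup.2 (𝒜.exists_mem x)

/-- Saturation in the form used by `Kato1994_logRegular_hasResolution`. [cite: Kato1994, (1.1)] -/
theorem saturated' (i : 𝒜.ι) (v : Fin (𝒜.rk i) → ℤ) (k : ℕ) (hk : 0 < k) (hv : k • v ∈ 𝒜.P i) :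
    v ∈ 𝒜.P i :=
  (𝒜.saturated i hv).resolve_left (Nat.pos_iff_ne_zero.1 hk)

/-- The chart at a point: `φ_{i,x} : P i → (𝒪_{X,x}, ·)`, the chart followed by the germ map.
[cite: Kato1994, (1.5)–(1.6)] -/
def stalkChart (i : 𝒜.ι) (x : X) (hx : x ∈ 𝒜.U i) :
    Multiplicative (𝒜.P i) →* (X.presheaf.stalk x : Type u) :=
  (X.presheaf.germ (𝒜.U i) x hx).hom.toMonoidHom.comp (𝒜.chart i)

/-- Unfolding `stalkChart` (`rfl`). [cite: Kato1994, (1.5)] -/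
@[simp] theorem stalkChart_apply (i : 𝒜.ι) (x : X) (hx : x ∈ 𝒜.U i) (p : Multiplicative (𝒜.P i)) :
    𝒜.stalkChart i x hx p = X.presheaf.germ (𝒜.U i) x hx (𝒜.chart i p) :=
  rfl

/-- **Logarithmic regularity** of the (S) log scheme presented by the atlas `𝒜` (Kato 1994,
Def. (2.1): regular at all `x ∈ X`): `X` is locally Noetherian (part of condition (S)) and at every
point `x` of every chart domain `U i` the chart `φ_{i,x} : P i → 𝒪_{X,x}` satisfies (2.1)
(`LogChart.IsLogRegularLocal`: `𝒪_{X,x}/I(x)` regular and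
`dim 𝒪_{X,x} = dim 𝒪_{X,x}/I(x) + rank ((P i)ᵍᵖ/Fᵍᵖ)`). The condition is asked for EVERY chart
through `x` (for a genuine log structure it depends only on `M_x`; asking it for all charts is what
makes the atlas glue to one, see "Faithfulness" in the module docstring).
[cite: Kato1994, Def. (2.1)] [cite: Niziol2006, Def. 2.2 and Lemma 2.3] -/
structure IsLogRegular : Prop where
  /-- `X` is locally Noetherian (condition (S)) -/
  isLocallyNoetherian : IsLocallyNoetherian X
  /-- Kato's (2.1) at every point of every chart -/
  isLogRegularLocal : ∀ (i : 𝒜.ι) (x : X) (hx : x ∈ 𝒜.U i),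
    LogChart.IsLogRegularLocal (𝒜.P i) (𝒜.stalkChart i x hx)

/-! ### The open set of triviality -/

/-- The **locus of triviality** `X_tr` of the log structure presented by `𝒜`: the points `x` at
which (some, equivalently every, `mem_trivialLocus_iff`) chart through `x` takes only unit values in
`𝒪_{X,x}`, i.e. `M_x = 𝒪^×_{X,x}`. [cite: Kato1994, Thm. (11.6)] [cite: Niziol2006, Prop. 2.6] -/
def trivialLocus : Set X :=
  {x | ∃ i, ∃ hx : x ∈ 𝒜.U i, ∀ p : 𝒜.P i, IsUnit (𝒜.stalkChart i x hx (Multiplicative.ofAdd p))}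

/-- Chart independence of triviality at a point (from the compatibility of the charts).
[folklore] -/
theorem forall_isUnit_iff {i j : 𝒜.ι} {x : X} (hi : x ∈ 𝒜.U i) (hj : x ∈ 𝒜.U j) :
    (∀ p : 𝒜.P i, IsUnit (𝒜.stalkChart i x hi (Multiplicative.ofAdd p))) ↔
      ∀ q : 𝒜.P j, IsUnit (𝒜.stalkChart j x hj (Multiplicative.ofAdd q)) := by
  constructor
  · intro h q
    obtain ⟨p, hp⟩ := 𝒜.chart_compatible j i x hj hi q
    exact hp.isUnit_iff.2 (h p)
  · intro h p
    obtain ⟨q, hq⟩ := 𝒜.chart_compatible i j x hi hj p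
    exact hq.isUnit_iff.2 (h q)

/-- `x ∈ X_tr` iff EVERY chart through `x` is by units at `x`. [folklore] -/
theorem mem_trivialLocus_iff (x : X) :
    x ∈ 𝒜.trivialLocus ↔ ∀ (i : 𝒜.ι) (hx : x ∈ 𝒜.U i) (p : 𝒜.P i),
      IsUnit (𝒜.stalkChart i x hx (Multiplicative.ofAdd p)) := by
  constructor
  · rintro ⟨i, hi, h⟩ j hj
    exact (𝒜.forall_isUnit_iff hi hj).1 h
  · intro h
    obtain ⟨i, hi⟩ := 𝒜.exists_mem x
    exact ⟨i, hi, h i hi⟩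

/-- The part of `X_tr` seen by one chart is open: it is `U i ∩ ⋂_{g ∈ S} D(φ_i g)` for a finite
generating set `S` of `P i`. [cite: Kato1994, Thm. (11.6)] -/
theorem isOpen_setOf_forall_isUnit (i : 𝒜.ι) :
    IsOpen {x : X | ∃ hx : x ∈ 𝒜.U i, ∀ p : 𝒜.P i,
      IsUnit (𝒜.stalkChart i x hx (Multiplicative.ofAdd p))} := by
  obtain ⟨S, hS⟩ := AddMonoid.fg_def.1 ((AddMonoid.fg_iff_addSubmonoid_fg _).2 (𝒜.fg i))
  have heq : {x : X | ∃ hx : x ∈ 𝒜.U i, ∀ p : 𝒜.P i,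
      IsUnit (𝒜.stalkChart i x hx (Multiplicative.ofAdd p))} =
      (𝒜.U i : Set X) ∩ ⋂ g ∈ S, (X.basicOpen (𝒜.chart i (Multiplicative.ofAdd g)) : Set X) := by
    ext x
    simp only [Set.mem_setOf_eq, Set.mem_inter_iff, Set.mem_iInter, SetLike.mem_coe]
    constructor
    · rintro ⟨hx, h⟩
      exact ⟨hx, fun g _ => (X.mem_basicOpen _ x hx).2 (h g)⟩
    · rintro ⟨hx, h⟩
      refine ⟨hx, fun p => ?_⟩
      have hp : p ∈ AddSubmonoid.closure (S : Set (𝒜.P i)) := by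
        rw [hS]
        exact AddSubmonoid.mem_top p
      induction hp using AddSubmonoid.closure_induction with
      | mem g hg => exact (X.mem_basicOpen _ x hx).1 (h g hg)
      | zero =>
        rw [ofAdd_zero, map_one]
        exact isUnit_one
      | add a b _ _ ha hb =>
        rw [ofAdd_add, map_mul]
        exact ha.mul hb
  rw [heq]
  exact (𝒜.U i).isOpen.inter (isOpen_biInter_finset fun g _ => (X.basicOpen _).isOpen)

/-- **The locus of triviality is open** (it is covered by the open pieces of
`isOpen_setOf_forall_isUnit`). [cite: Kato1994, Thm. (11.6)] [cite: Niziol2006, Prop. 2.6] -/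
theorem isOpen_trivialLocus : IsOpen 𝒜.trivialLocus := by
  have heq : 𝒜.trivialLocus = ⋃ i, {x : X | ∃ hx : x ∈ 𝒜.U i, ∀ p : 𝒜.P i,
      IsUnit (𝒜.stalkChart i x hx (Multiplicative.ofAdd p))} := by
    ext x
    simp only [trivialLocus, Set.mem_setOf_eq, Set.mem_iUnion]
  rw [heq]
  exact isOpen_iUnion fun i => 𝒜.isOpen_setOf_forall_isUnit i

/-- **Kato (2.2)(1) on the locus of triviality**: if `𝒜` is log regular then `X` is regular (in
the classical sense) at every point of `X_tr`. [cite: Kato1994, (2.2)(1)] -/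
theorem IsLogRegular.isRegularLocalRing_of_mem_trivialLocus {𝒜 : LogAtlas.{w} X}
    (h : 𝒜.IsLogRegular) {x : X} (hx : x ∈ 𝒜.trivialLocus) :
    IsRegularLocalRing (X.presheaf.stalk x) := by
  obtain ⟨i, hxi, hunits⟩ := hx
  exact (LogChart.isLogRegularLocal_iff_of_forall_isUnit (𝒜.P i) (𝒜.span_eq_top i) _ hunits).1
    (h.isLogRegularLocal i x hxi)

/-! ### On affine opens the stalk condition is `LogChart.IsLogRegularAt` -/

/-- On an affine open `V ⊆ U i`, Kato's condition at `x ∈ V` for the chart `φ_{i,x}` is the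
one-chart affine predicate `LogChart.IsLogRegularAt` for the ring `Γ(X, V)`, the restricted chart
`P i → Γ(X, U i) → Γ(X, V)` and the prime ideal of `x` (because `𝒪_{X,x} ≅ Γ(X, V)_𝔭`).
[cite: Kato1994, Def. (2.1)] -/
theorem isLogRegularLocal_stalkChart_iff (i : 𝒜.ι) {V : X.Opens} (hV : IsAffineOpen V)
    (hVU : V ≤ 𝒜.U i) (x : X) (hx : x ∈ V) :
    LogChart.IsLogRegularLocal (𝒜.P i) (𝒜.stalkChart i x (hVU hx)) ↔
      LogChart.IsLogRegularAt (𝒜.P i)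
        ((X.presheaf.map (homOfLE hVU).op).hom.toMonoidHom.comp (𝒜.chart i))
        (hV.primeIdealOf ⟨x, hx⟩).asIdeal := by
  letI alg : Algebra Γ(X, V) (X.presheaf.stalk x) := (X.presheaf.germ V x hx).hom.toAlgebra
  haveI : IsLocalization.AtPrime (X.presheaf.stalk x) (hV.primeIdealOf ⟨x, hx⟩).asIdeal :=
    hV.isLocalization_stalk ⟨x, hx⟩
  let e : Localization.AtPrime (hV.primeIdealOf ⟨x, hx⟩).asIdeal ≃ₐ[Γ(X, V)]
      (X.presheaf.stalk x : Type u) :=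
    IsLocalization.algEquiv (hV.primeIdealOf ⟨x, hx⟩).asIdeal.primeCompl _ _
  rw [LogChart.isLogRegularAt_iff_isLogRegularLocal,
    ← LogChart.isLogRegularLocal_comp_equiv _ _ e.toRingEquiv]
  have hcharts : e.toRingEquiv.toMonoidHom.comp
      ((algebraMap Γ(X, V)
          (Localization.AtPrime (hV.primeIdealOf ⟨x, hx⟩).asIdeal)).toMonoidHom.comp
        ((X.presheaf.map (homOfLE hVU).op).hom.toMonoidHom.comp (𝒜.chart i))) =
      𝒜.stalkChart i x (hVU hx) := by
    refine MonoidHom.ext fun p => ?_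
    change e (algebraMap Γ(X, V) _ ((X.presheaf.map (homOfLE hVU).op).hom (𝒜.chart i p))) =
      (X.presheaf.germ (𝒜.U i) x (hVU hx)).hom (𝒜.chart i p)
    rw [AlgEquiv.commutes, RingHom.algebraMap_toAlgebra]
    exact TopCat.Presheaf.germ_res_apply X.presheaf (homOfLE hVU) x hx _
  rw [hcharts]

/-! ### Change of index type -/

/-- Reindex an atlas along an equivalence of (finite) index types. [folklore] -/
def reindex {κ : Type w'} (e : κ ≃ 𝒜.ι) : LogAtlas.{w'} X where
  ι := κ
  finite_index := Finite.of_equiv _ e.symm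
  U k := 𝒜.U (e k)
  exists_mem x := by
    obtain ⟨i, hi⟩ := 𝒜.exists_mem x
    exact ⟨e.symm i, by rwa [e.apply_symm_apply]⟩
  rk k := 𝒜.rk (e k)
  P k := 𝒜.P (e k)
  fg k := 𝒜.fg (e k)
  saturated k := 𝒜.saturated (e k)
  span_eq_top k := 𝒜.span_eq_top (e k)
  chart k := 𝒜.chart (e k)
  chart_compatible k l x hk hl p := 𝒜.chart_compatible (e k) (e l) x hk hl p

/-- Log regularity is insensitive to reindexing. [folklore] -/
theorem IsLogRegular.reindex {𝒜 : LogAtlas.{w} X} (h : 𝒜.IsLogRegular) {κ : Type w'}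
    (e : κ ≃ 𝒜.ι) : (𝒜.reindex e).IsLogRegular :=
  ⟨h.isLocallyNoetherian, fun k x hx => h.isLogRegularLocal (e k) x hx⟩

/-! ### The trivial log structure -/

/-- The atlas of the **trivial log structure** `M = 𝒪^×_X`: one chart `U = X` by the zero monoid
`P = ℤ⁰`. [cite: Kato1994, (1.2) and (2.2)(1)] -/
def trivialStructure (X : Scheme.{u}) : LogAtlas.{w} X where
  ι := PUnit.{w + 1}
  U _ := ⊤
  exists_mem _ := ⟨⟨⟩, Opens.mem_top _⟩
  rk _ := 0
  P _ := ⊤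
  fg _ := AddMonoid.fg_def.mp inferInstance
  saturated _ := fun _ _ _ => Or.inr (AddSubmonoid.mem_top _)
  span_eq_top _ := Subsingleton.elim _ _
  chart _ := 1
  chart_compatible _ _ _ _ _ p := ⟨p, Associated.refl _⟩

/-- **Kato (2.2)(1)**: for the trivial log structure, `(X, 𝒪^×_X)` is log regular iff `X` is
regular (and locally Noetherian, which (S) presupposes). [cite: Kato1994, (2.2)(1)] -/
theorem isLogRegular_trivialStructure_iff (X : Scheme.{u}) :
    (trivialStructure.{w} X).IsLogRegular ↔ IsLocallyNoetherian X ∧ Scheme.IsRegular X := by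
  constructor
  · intro h
    exact ⟨h.isLocallyNoetherian, fun x =>
      (LogChart.isLogRegularLocal_zero_iff _ _).1 (h.isLogRegularLocal ⟨⟩ x (Opens.mem_top _))⟩
  · rintro ⟨hN, hreg⟩
    exact ⟨hN, fun i x hx => (LogChart.isLogRegularLocal_zero_iff _ _).2 (hreg x)⟩

/-! ### One global chart on an affine scheme -/

/-- The atlas on `Spec A` with ONE GLOBAL CHART `φ : P → (A, ·)` (`P ⊆ ℤⁿ` finitely generated,
saturated, spanning) — the setting of `LogChart.IsLogRegularAt` and of the named fact
`Kato1994_logRegular_hasResolution`. [cite: Kato1994, (1.5)] -/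
def ofAffineChart (A : Type u) [CommRing A] {n : ℕ} (P : AddSubmonoid (Fin n → ℤ)) (hfg : P.FG)
    (hsat : P.NSMulSaturated) (hspan : Submodule.span ℤ (P : Set (Fin n → ℤ)) = ⊤)
    (φ : Multiplicative P →* A) : LogAtlas.{w} (Spec (.of A)) where
  ι := PUnit.{w + 1}
  U _ := ⊤
  exists_mem _ := ⟨⟨⟩, Opens.mem_top _⟩
  rk _ := n
  P _ := P
  fg _ := hfg
  saturated _ := hsat
  span_eq_top _ := hspan
  chart _ := (Scheme.ΓSpecIso (.of A)).inv.hom.toMonoidHom.comp φ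
  chart_compatible _ _ _ _ _ p := ⟨p, Associated.refl _⟩

/-- For one global chart on `Spec A`, log regularity in the sense of this file is: `A` is
Noetherian and `LogChart.IsLogRegularAt P φ 𝔭` at every prime `𝔭` — exactly the hypotheses of
`Kato1994_logRegular_hasResolution` (because `𝒪_{Spec A, 𝔭} ≅ A_𝔭`). [cite: Kato1994, Def. (2.1)] -/
theorem isLogRegular_ofAffineChart_iff (A : Type u) [CommRing A] {n : ℕ}
    (P : AddSubmonoid (Fin n → ℤ)) (hfg : P.FG) (hsat : P.NSMulSaturated)
    (hspan : Submodule.span ℤ (P : Set (Fin n → ℤ)) = ⊤) (φ : Multiplicative P →* A) :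
    (ofAffineChart.{w} A P hfg hsat hspan φ).IsLogRegular ↔
      IsNoetherianRing A ∧ ∀ (𝔭 : Ideal A) [𝔭.IsPrime], LogChart.IsLogRegularAt P φ 𝔭 := by
  have key : ∀ x : Spec (.of A),
      LogChart.IsLogRegularLocal P ((ofAffineChart.{w} A P hfg hsat hspan φ).stalkChart ⟨⟩ x
        (Opens.mem_top _)) ↔ LogChart.IsLogRegularAt P φ x.asIdeal := by
    intro x
    let e : (Spec (.of A)).presheaf.stalk x ≃+* Localization.AtPrime x.asIdeal :=
      (Spec.stalkIso (.of A) x).commRingCatIsoToRingEquiv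
    rw [LogChart.isLogRegularAt_iff_isLogRegularLocal,
      ← LogChart.isLogRegularLocal_comp_equiv _ _ e.symm]
    have hcharts : (ofAffineChart.{w} A P hfg hsat hspan φ).stalkChart ⟨⟩ x (Opens.mem_top _) =
        e.symm.toMonoidHom.comp
          ((algebraMap A (Localization.AtPrime x.asIdeal)).toMonoidHom.comp φ) := by
      refine MonoidHom.ext fun p => ?_
      have h1 := DFunLike.congr_fun
        (congrArg CommRingCat.Hom.hom (Spec.algebraMap_stalkIso_inv (R := .of A) x)) (φ p)
      simp only [CommRingCat.hom_comp, RingHom.comp_apply, CommRingCat.hom_ofHom] at h1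
      change ((Spec (.of A)).presheaf.germ ⊤ x (Opens.mem_top x)).hom
          ((Scheme.ΓSpecIso (.of A)).inv.hom (φ p)) =
        (Spec.stalkIso (.of A) x).inv.hom (algebraMap A (Localization.AtPrime x.asIdeal) (φ p))
      exact h1.symm
    rw [hcharts]
  constructor
  · intro h
    refine ⟨isLocallyNoetherian_Spec.1 h.isLocallyNoetherian, fun 𝔭 _ => ?_⟩
    exact (key ⟨𝔭, ‹_›⟩).1 (h.isLogRegularLocal ⟨⟩ _ (Opens.mem_top _))
  · rintro ⟨hN, hreg⟩
    refine ⟨isLocallyNoetherian_Spec.2 hN, fun i x hx => ?_⟩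
    exact (key x).2 (hreg x.asIdeal)

end LogAtlas

/-! ## Log regular schemes -/

/-- A **logarithmically regular scheme** ("scheme with at worst toric singularities", Kato 1994
§2): a scheme together with an atlas of finitely many fs Zariski charts which is log regular
(`LogAtlas.IsLogRegular`: locally Noetherian and Kato's (2.1) at every point of every chart). By
"Faithfulness" in the module docstring this is the same as a quasi-compact-style log scheme
`(X, M)` with condition (S) which is regular in the sense of Kato (2.1), `M = 𝒪_X ∩ j_*𝒪^×_{X_tr}`
being recovered from the atlas (11.6). [cite: Kato1994, Def. (2.1) with (1.5)] -/
structure LogRegularScheme where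
  /-- the underlying scheme -/
  toScheme : Scheme.{u}
  /-- the fs Zariski atlas presenting the log structure -/
  atlas : LogAtlas.{u} toScheme
  /-- Kato's regularity (2.1) everywhere -/
  isLogRegular : atlas.IsLogRegular

/-- `X` **underlies a log regular scheme**: SOME finite atlas of fs Zariski charts on `X` is log
regular — `X` has at worst toric singularities for some fs Zariski log structure (Kato 1994 §2).
This is the hypothesis under which Kato (10.4) / Nizioł Thm. 5.8 resolve `X`.
[cite: Kato1994, Def. (2.1) with (1.5)] -/
def Scheme.IsLogRegular (X : Scheme.{u}) : Prop :=
  ∃ 𝒜 : LogAtlas.{u} X, 𝒜.IsLogRegular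

/-- A log regular atlas with any (finite) index type witnesses `Scheme.IsLogRegular` (reindex by
`Fin (card ι)` lifted to the universe of the scheme). [folklore] -/
theorem LogAtlas.IsLogRegular.isLogRegular_scheme {X : Scheme.{u}} {𝒜 : LogAtlas.{w} X}
    (h : 𝒜.IsLogRegular) : Scheme.IsLogRegular X :=
  ⟨𝒜.reindex (Equiv.ulift.trans (Finite.equivFin 𝒜.ι).symm), h.reindex _⟩

/-- The scheme underlying a `LogRegularScheme` is log regular. [cite: Kato1994, Def. (2.1)] -/
theorem LogRegularScheme.isLogRegular_toScheme (𝔛 : LogRegularScheme.{u}) :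
    Scheme.IsLogRegular 𝔛.toScheme :=
  ⟨𝔛.atlas, 𝔛.isLogRegular⟩

/-- **Kato (2.2)(1)**: a regular, locally Noetherian scheme is log regular (for the trivial log
structure). [cite: Kato1994, (2.2)(1)] -/
theorem Scheme.IsRegular.isLogRegular {X : Scheme.{u}} [IsLocallyNoetherian X]
    (h : Scheme.IsRegular X) : Scheme.IsLogRegular X :=
  ⟨LogAtlas.trivialStructure.{u} X, (LogAtlas.isLogRegular_trivialStructure_iff X).2 ⟨‹_›, h⟩⟩

/-- The one-chart affine case: if `A` is Noetherian and `(Spec A, Pᵃ)` is log regular at every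
prime in the sense of `LogChart.IsLogRegularAt`, then `Spec A` is log regular in the sense of this
file. [cite: Kato1994, Def. (2.1)] -/
theorem Scheme.isLogRegular_Spec_of_isLogRegularAt (A : Type u) [CommRing A] [IsNoetherianRing A]
    {n : ℕ} (P : AddSubmonoid (Fin n → ℤ)) (hfg : P.FG) (hsat : P.NSMulSaturated)
    (hspan : Submodule.span ℤ (P : Set (Fin n → ℤ)) = ⊤) (φ : Multiplicative P →* A)
    (h : ∀ (𝔭 : Ideal A) [𝔭.IsPrime], LogChart.IsLogRegularAt P φ 𝔭) :
    Scheme.IsLogRegular (Spec (.of A)) :=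
  ⟨LogAtlas.ofAffineChart.{u} A P hfg hsat hspan φ,
    (LogAtlas.isLogRegular_ofAffineChart_iff A P hfg hsat hspan φ).2 ⟨‹_›, h⟩⟩

/-- Consistency with the one-chart named fact: under `Kato1994_logRegular_hasResolution`, a log
regular one-chart atlas on `Spec A` gives a resolution of `Spec A`.
[cite: Kato1994, (10.4) with (9.8), (9.11), (10.3)] -/
theorem LogAtlas.IsLogRegular.hasResolution_ofAffineChart
    (hK : Kato1994_logRegular_hasResolution.{u}) {A : Type u} [CommRing A] {n : ℕ}
    {P : AddSubmonoid (Fin n → ℤ)} {hfg : P.FG} {hsat : P.NSMulSaturated}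
    {hspan : Submodule.span ℤ (P : Set (Fin n → ℤ)) = ⊤} {φ : Multiplicative P →* A}
    (h : (LogAtlas.ofAffineChart.{w} A P hfg hsat hspan φ).IsLogRegular) :
    Scheme.HasResolution (Spec (.of A)) := by
  obtain ⟨hN, hreg⟩ := (LogAtlas.isLogRegular_ofAffineChart_iff A P hfg hsat hspan φ).1 h
  haveI := hN
  exact hK A n P φ hfg (fun v k hk hv => (hsat hv).resolve_left (Nat.pos_iff_ne_zero.1 hk)) hspan
    (fun 𝔭 _ => hreg 𝔭)

/-! ## Named fact: resolution of log regular schemes (Kato (10.4), several charts) -/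

/-- NAMED FACT — **Kato 1994, (10.4), for a quasi-compact log regular scheme with several Zariski
charts**: "Assume `X` is quasi-compact (then `F(X)` is finite as is easily seen). We give a standard
way to resolve the singularity of `X`. Take a subdivision `F'` of `F(X)` which is proper over `F(X)`
such that for any `x ∈ F'`, `M_{F',x} ≅ ℕ^{r(x)}` for some `r(x) ≥ 0` (9.8). Let
`(X', M') = (X, M) ×_{F(X)} F'`. Then `(X', M')` is regular (10.3) and for `x ∈ X'`,
`M'_x/𝒪^×_{X',x} ≅ ℕ^{r(x)}` for some `r(x) ≥ 0`. Hence `X'` is a regular scheme in the usual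
sense."
— together with (9.8) (= [KKMS] Ch. I Thm. 11: such proper subdivisions of finite fans exist),
(9.11) (the underlying morphism of `(X, M) ×_F F' → (X, M)` is proper for a proper subdivision) and
(10.3) (`X' → X` is birational: an isomorphism over the dense open locus of triviality `X_tr`,
with dense preimage `X'_tr`). Here `(X, M)` is a log scheme with condition (S) on the Zariski site
which is regular in the sense of (2.1) — in this file: a quasi-compact scheme `X` with an atlas of
finitely many fs Zariski charts `𝒜` such that `𝒜.IsLogRegular` (see "Faithfulness" in the module
docstring) — and the conclusion is vendored in the weak form of the tree, `Scheme.HasResolution X`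
(some proper birational `X' → X` with `X'` regular). The same theorem with the resolving morphism a
single log blow-up is Nizioł 2006, Thm. 5.8 ("Any log-regular Zariski scheme `(X, M_X)` can be
desingularized by a log-blow-up"). The one-chart affine case `Kato1994_logRegular_hasResolution` of
`LogRegularResolution.lean` follows from this fact
(`Kato1994_logRegularScheme_hasResolution.one_chart`). Users take
`(h : Kato1994_logRegularScheme_hasResolution)`.
[cite: Kato1994, (10.4) with (9.8), (9.11), (10.3)] [cite: Niziol2006, Thm. 5.8]
-- TODO(general form): charts on the étale site (Nizioł's theorem is for Zariski log structures on
-- `X_ét`; Gabber's refinement, Illusie–Laszlo–Orgogozo 2014, Exp. VIII), and the finer conclusions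
-- (the resolution is a log blow-up, projective, an isomorphism over the regular locus) — none of
-- which is asserted here. -/
def Kato1994_logRegularScheme_hasResolution : Prop :=
  ∀ (X : Scheme.{u}) (𝒜 : LogAtlas.{u} X), CompactSpace X → 𝒜.IsLogRegular →
    Scheme.HasResolution X

/-- The fact applied through `Scheme.IsLogRegular`. [cite: Kato1994, (10.4)] -/
theorem Kato1994_logRegularScheme_hasResolution.hasResolution
    (h : Kato1994_logRegularScheme_hasResolution.{u}) {X : Scheme.{u}} [CompactSpace X]
    (hX : Scheme.IsLogRegular X) : Scheme.HasResolution X := by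
  obtain ⟨𝒜, h𝒜⟩ := hX
  exact h X 𝒜 ‹_› h𝒜

/-- **Consistency**: the several-charts fact implies the one-chart affine fact
`Kato1994_logRegular_hasResolution` (via the one-chart atlas `LogAtlas.ofAffineChart` and
`LogAtlas.isLogRegular_ofAffineChart_iff`; `Spec A` is quasi-compact).
[cite: Kato1994, (10.4)] -/
theorem Kato1994_logRegularScheme_hasResolution.one_chart
    (h : Kato1994_logRegularScheme_hasResolution.{u}) : Kato1994_logRegular_hasResolution.{u} := by
  intro A _ _ n P φ hfg hsat hspan hreg
  have hsat' : P.NSMulSaturated := fun k v hkv =>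
    (Nat.eq_zero_or_pos k).imp id fun hk => hsat v k hk hkv
  exact h (Spec (.of A)) (LogAtlas.ofAffineChart A P hfg hsat' hspan φ) inferInstance
    ((LogAtlas.isLogRegular_ofAffineChart_iff A P hfg hsat' hspan φ).2 ⟨‹_›, fun 𝔭 _ => hreg 𝔭⟩)

end Literature.AlgebraicGeometry.Resolution

end
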